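import Literature.IUT.LogVolume.Corollary22PartIIWith
import Literature.IUT.LogVolume.Corollary22OfThm110
import Literature.NumberTheory.DiophantineGeometry.GenEllThm21With
import HarnessLib

/-!
# [IUTchIV] §2 endpoint WITH AN EXPONENT `Λ ≥ 1`: `Thm110LegendreWith Λ` ⇒ Cor. 2.2_Λ ⇒ Cor. 2.3 bookkeeping
# ⇒ [GenEll] Thm. 2.1 (ii)_Λ at `Σ = {2}` ⇒ abc with exponent `Λ` (on cusp-avoiding families; on all triples
# modulo the `With`-shape of [GenEll] Thm. 2.1)

Mochizuki, *Inter-universal Teichmüller theory IV*, RIMS manuscript (Apr. 2020; = PRIMS **57** (2021)),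
Cor. 2.2 (pp. 41–48), Cor. 2.3 (pp. 54–55); Mochizuki, *Arithmetic elliptic curves in general position* [GenEll]
Thm. 2.1 (p. 11–13). PROOF-ONLY file (no definitions); it only COMPOSES landed theorems — the `Λ`-port of the
record endpoint `Corollary22OfThm110.lean` (`abcCompactlyBounded_two_of_thm110Legendre`, `abc_of_thm110Legendre`)
over the `With`-predicates of `Corollary22With.lean` ([IUTchIV] side: `Thm110LegendreWith`, `PartIIWith`,
`Corollary22With`) and `GenEllThm21With.lean` ([GenEll] side: `VojtaIneqWith`, `ABCCompactlyBoundedWith`,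
`VojtaP1DegWith`, `GenEll_thm21_primesWith`, `ABCWithExponent`, `ABCWithExponentOn`).

TAKES NO SIDE on the disputed step. The hypothesis `Cor22.Thm110LegendreWith Λ` is the display of [IUTchIV]
Thm. 1.10 (which rests on [IUTchIII] Cor. 3.12) with its whole right-hand side multiplied by `Λ` — at `Λ = 1` the
record interface, for `Λ > 1` what a conditional "loss" line of the tree delivers; a HYPOTHESIS, never asserted.
Everything between it and the [GenEll] side is PROVED in the tree: Cor. 2.2 (i) (`partI_holds`), (ii)_Λ
(`partIIWith_of_thm110LegendreWith`, with its classical Galois-image input DISCHARGED, `fullGaloisImage_holds`),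
(iii) (`exists_threshold_partIII_of_partI`), the Cor. 2.3 bookkeeping (`bdLe_of_corollary22With`), the
"WLOG (∗^{j-inv})" sentence of p. 55 (`jInvVacuous_holds`). Hence, kernel-checked:

* `abcCompactlyBoundedWith_two_of_thm110LegendreWith : 1 ≤ Λ → Thm110LegendreWith Λ → ABCCompactlyBoundedWith {2} Λ`
  — [GenEll] Thm. 2.1 (ii)_Λ at `Σ = {2}` (the end of the [IUTchIV] §2 chain proper);
* `abcExpOn_farFromCusps_of_thm110LegendreWith` — abc WITH EXPONENT `Λ` on every cusp-avoiding family of triples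
  (`ρ`-far from the cusps at `∞` and `2`; constants `C(ρ, ε)`), through the LOSS-FREE annulus half of
  (ii) ⇒ (i) (`abcExpOn_farFromCusps_of_abcCompactlyBoundedWith`, no Belyi map) — unconditional in the
  [GenEll] side;
* `abcExp_of_thm110LegendreWith : 1 ≤ Λ → Thm110LegendreWith Λ → GenEll_thm21_primesWith Λ → ABCWithExponent Λ`
  — abc with exponent `Λ` for ALL triples, MODULO the explicit hypothesis `GenEll_thm21_primesWith Λ`
  («(ii)_Λ ⇒ (i)_Λ» with the coefficient carried): PROVED at `Λ = 1` (`GenEll_thm21_primes_holds`), and for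
  `Λ > 1` NOT a statement of [GenEll] and NOT in reach of the printed noncritical-Belyi mechanism (exponent
  rigidity, `GenEll.belyi_slope_not_pos`) — an open hypothesis carried by name, asserted by nobody.

The `Λ = 1` regressions recover the record chain BY NAME (`abcCompactlyBounded_two_of_thm110LegendreWith_one`,
`abc_of_thm110LegendreWith_one`). Nothing here asserts that abc (with any exponent) is proved or refuted, or
that any display holds at any datum; typed ≠ proved.
-/

noncomputable section

namespace Literature.IUT.LogVolume

namespace Cor22

open Literature.NumberTheory.DiophantineGeometry.GenEll Literature.NumberTheory.DiophantineGeometry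

/-- `{2}` is a set of primes. [folklore] -/
private theorem primes_two : ∀ p ∈ ({2} : Finset ℕ), p.Prime := fun p hp => by
  rw [Finset.mem_singleton] at hp; subst hp; exact Nat.prime_two

/-- `0 < μ ≤ 1 ⟹ 1 ≤ 1/μ` (the exponent of a dilation `μ`). [folklore] -/
private theorem one_le_one_div_of_le_one {μ : ℝ} (hμ0 : 0 < μ) (hμ1 : μ ≤ 1) : 1 ≤ 1 / μ :=
  one_le_one_div hμ0 hμ1

/-! ## Cor. 2.2_Λ (ii), uniform form -/

/-- **[IUTchIV] Corollary 2.2 (ii) with the exponent `Λ ≥ 1`, uniform form** ("`H_unif` … independent of `K_V`"):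
from the dilated interface and the classical Galois-image input, `∃ H_II, ∀ K_V (hypotheses of Cor. 2.2),
PartIIWith K_V H_II Λ` (`H_II = 2^{140}·Λ⁵`; the `Λ`-twin of `exists_partII_of_thm110Legendre`).
[claim: Mochizuki2012, status: disputed] -/
theorem exists_partIIWith_of_thm110LegendreWith {Λ : ℝ} (hΛ : 1 ≤ Λ) (h110 : Thm110LegendreWith Λ)
    (hFG : FullGaloisImage) : ∃ HII : ℝ, ∀ D : CBData, Hypotheses D → PartIIWith D HII Λ := by
  obtain ⟨η, hη⟩ := exists_isEtaPrm
  exact ⟨2 ^ 140 * Λ ^ 5, fun D hD => partIIWith_of_thm110LegendreWith hΛ h110 hFG hη D hD⟩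

/-! ## Cor. 2.2_Λ ⟹ [GenEll] Thm. 2.1 (ii)_Λ at `Σ = {2}` (the proof of Cor. 2.3, p. 55, with the exponent) -/

/-- The Cor. 2.2 step of the proof of Cor. 2.3 (p. 55) with the exponent `Λ ≥ 1`, in the [GenEll] `With`
vocabulary: parts (i), (ii)_Λ, (iii) for `K_V` give `VojtaIneqWith K_V d Λ ε` (`ht ≲ Λ·(1+ε)·(log-diff +
log-cond)` on `K_V ∩ U_P(ℚ̄)^{≤d}`) for every `d ≥ 1`, `ε > 0` — `bdLe_of_corollary22With` read through
`vojtaIneqWith_iff_bdLe`. [claim: Mochizuki2012, status: disputed] -/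
theorem vojtaIneqWith_of_corollary22With {Λ : ℝ} (hΛ : 1 ≤ Λ) {D : CBData} {Hunif : ℝ} (hI : PartI D)
    (hII : PartIIWith D Hunif Λ) (hIII : PartIII D Hunif) {d : ℕ} (hd : 0 < d) {ε : ℝ} (hε : 0 < ε) :
    VojtaIneqWith D.toSet d Λ ε :=
  (vojtaIneqWith_iff_bdLe D.toSet d Λ ε).2 (bdLe_of_corollary22With hΛ hI hII hIII hd hε)

/-- **Cor. 2.2_Λ ⟹ [GenEll] Thm. 2.1 (ii)_Λ for `Σ = {2}`** (the proof of Cor. 2.3, p. 55, with the exponent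
carried, minus its final appeal to [GenEll] Thm. 2.1): PROVED as an implication from `Corollary22With Λ H_unif`
and the printed vacuity remark `JInvVacuous` ("(∗^{j-inv}) is vacuous for fixed `d`"). The `Λ`-twin of
`abcCompactlyBounded_two_of_corollary22`. [claim: Mochizuki2012, status: disputed] -/
theorem abcCompactlyBoundedWith_two_of_corollary22With {Λ Hunif : ℝ} (hΛ : 1 ≤ Λ)
    (h22 : Corollary22With Λ Hunif) (hvac : JInvVacuous) : ABCCompactlyBoundedWith {2} Λ := by
  intro d hd ε hε D hD
  obtain ⟨D', hD', hsub⟩ := hvac D hD d hd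
  obtain ⟨hI, hII, hIII⟩ := h22.2 D' hD'
  have h := vojtaIneqWith_of_corollary22With hΛ hI hII hIII hd hε
  rw [vojtaIneqWith_iff_bdLe] at h ⊢
  exact h.mono fun P hP => ⟨hsub hP, hP.2⟩

/-- **[GenEll] Thm. 2.1 (ii)_Λ for `Σ = {2}` from the DILATED Theorem-1.10 interface** (`Λ ≥ 1`):
`Thm110LegendreWith Λ → ABCCompactlyBoundedWith {2} Λ`, via `exists_corollary22With_of_thm110LegendreWith` (with
the Galois-image input DISCHARGED, `fullGaloisImage_holds`), `abcCompactlyBoundedWith_two_of_corollary22With` and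
`jInvVacuous_holds`. This is where the [IUTchIV] §2 chain with an exponent ENDS (rh-lead ruling R19: the passage
to all triples is the [GenEll] side's business). The `Λ`-twin of `abcCompactlyBounded_two_of_thm110Legendre`.
[claim: Mochizuki2012, status: disputed] -/
theorem abcCompactlyBoundedWith_two_of_thm110LegendreWith {Λ : ℝ} (hΛ : 1 ≤ Λ) (hH : Thm110LegendreWith Λ) :
    ABCCompactlyBoundedWith ({2} : Finset ℕ) Λ := by
  obtain ⟨Hunif, h22⟩ := exists_corollary22With_of_thm110LegendreWith hΛ hH fullGaloisImage_holds
  exact abcCompactlyBoundedWith_two_of_corollary22With hΛ h22 jInvVacuous_holds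

/-- The same in the dilation currency `μ = 1/Λ` (`0 < μ ≤ 1`): `Thm110LegendreWith (1/μ) →
ABCCompactlyBoundedWith {2} (1/μ)`. [claim: Mochizuki2012, status: disputed] -/
theorem abcCompactlyBoundedWith_two_of_thm110LegendreWith_one_div {μ : ℝ} (hμ0 : 0 < μ) (hμ1 : μ ≤ 1)
    (hH : Thm110LegendreWith (1 / μ)) : ABCCompactlyBoundedWith ({2} : Finset ℕ) (1 / μ) :=
  abcCompactlyBoundedWith_two_of_thm110LegendreWith (one_le_one_div_of_le_one hμ0 hμ1) hH

/-! ## abc with exponent `Λ` on cusp-avoiding families (transfer-free; the [GenEll] side unconditional) -/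

/-- **The DILATED Theorem-1.10 interface ⟹ abc WITH EXPONENT `Λ` ON EVERY CUSP-AVOIDING FAMILY OF TRIPLES**
(`Λ ≥ 1`): for every `0 < ρ ≤ 1/2`, `∀ ε > 0 ∃ C = C(ρ, ε) > 0`, `c < C·rad(abc)^{Λ(1+ε)}` for all abc triples
whose point `λ = a/c` is `ρ`-far from the cusps at `∞` and at `2` (`NFPoint.FarFromCusps {2} ρ`; concretely
`min(a, b) ≥ ρ·c` and the `2`-adic valuations of `a/c`, `b/c` in `[log₂ ρ, −log₂ ρ]`). Composition of
`abcCompactlyBoundedWith_two_of_thm110LegendreWith` with the LOSS-FREE annulus half of [GenEll] Thm. 2.1 (ii) ⇒ (i)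
(`abcExpOn_farFromCusps_of_abcCompactlyBoundedWith`: no Belyi map, no hypothesis on the [GenEll] side). No single
such family contains all abc triples (that is what the Belyi maps are for). CONDITIONAL on `hH` only.
[claim: Mochizuki2012, status: disputed] -/
theorem abcExpOn_farFromCusps_of_thm110LegendreWith {Λ : ℝ} (hΛ : 1 ≤ Λ) (hH : Thm110LegendreWith Λ)
    {ρ : ℝ} (h0 : 0 < ρ) (h2 : ρ ≤ 1 / 2) :
    ABCWithExponentOn {P : NFPoint | P.FarFromCusps {2} ρ} Λ :=
  abcExpOn_farFromCusps_of_abcCompactlyBoundedWith primes_two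
    (abcCompactlyBoundedWith_two_of_thm110LegendreWith hΛ hH) h0 h2

/-- The same in the dilation currency `μ = 1/Λ` (`0 < μ ≤ 1`): exponent `(1/μ)·(1+ε)` on every cusp-avoiding
family. [claim: Mochizuki2012, status: disputed] -/
theorem abcExpOn_farFromCusps_of_thm110LegendreWith_one_div {μ : ℝ} (hμ0 : 0 < μ) (hμ1 : μ ≤ 1)
    (hH : Thm110LegendreWith (1 / μ)) {ρ : ℝ} (h0 : 0 < ρ) (h2 : ρ ≤ 1 / 2) :
    ABCWithExponentOn {P : NFPoint | P.FarFromCusps {2} ρ} (1 / μ) :=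
  abcExpOn_farFromCusps_of_thm110LegendreWith (one_le_one_div_of_le_one hμ0 hμ1) hH h0 h2

/-- **abc with exponent `Λ` ON ANY COMPACTLY BOUNDED `K_V` whose support contains `2`** (triples with
`λ = a/c ∈ K_V`), from the dilated interface: (ii)_Λ at `Σ = {2}` applied to `K_V` itself in degree `1`
(`abcExpOn_toSet_of_abcCompactlyBoundedWith`). [claim: Mochizuki2012, status: disputed] -/
theorem abcExpOn_toSet_of_thm110LegendreWith {Λ : ℝ} (hΛ : 1 ≤ Λ) (hH : Thm110LegendreWith Λ) (D : CBData)
    (hD : D.SupportContains {2}) : ABCWithExponentOn D.toSet Λ :=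
  abcExpOn_toSet_of_abcCompactlyBoundedWith (abcCompactlyBoundedWith_two_of_thm110LegendreWith hΛ hH) D hD

/-! ## abc with exponent `Λ` for all triples, modulo the `With`-shape of [GenEll] Thm. 2.1 -/

/-- **[IUTchIV] Corollary 2.3 with the exponent `Λ` for `(ℙ¹_ℚ, {0,1,∞})`, every degree `d`**, from the dilated
interface AND the explicit hypothesis `GenEll_thm21_primesWith Λ` («(ii)_Λ ⇒ (i)_Λ|_{ℙ¹}» with the coefficient
carried — PROVED at `Λ = 1` only; for `Λ > 1` not in print and not in reach of the printed Belyi mechanism,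
`GenEll.belyi_slope_not_pos`; open, asserted by nobody): `VojtaP1DegWith d Λ`. The `Λ`-twin of
`vojtaP1Deg_of_thm110Legendre`. [claim: Mochizuki2012, status: disputed] -/
theorem vojtaP1DegWith_of_thm110LegendreWith {Λ : ℝ} (hΛ : 1 ≤ Λ) (hH : Thm110LegendreWith Λ)
    (hfact : GenEll_thm21_primesWith Λ) {d : ℕ} (hd : 0 < d) : VojtaP1DegWith d Λ :=
  hfact {2} primes_two (abcCompactlyBoundedWith_two_of_thm110LegendreWith hΛ hH) d hd

/-- **abc WITH EXPONENT `Λ` for ALL triples from the DILATED Theorem-1.10 interface, MODULO the `With`-shape of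
[GenEll] Thm. 2.1**: `1 ≤ Λ → Thm110LegendreWith Λ → GenEll_thm21_primesWith Λ → ABCWithExponent Λ`
(`∀ ε > 0 ∃ C > 0 ∀ abc triples, c < C·rad(abc)^{Λ(1+ε)}`). BOTH hypotheses are explicit and named:
`Thm110LegendreWith Λ` (the dilated display; rests at `Λ = 1` on [IUTchIII] Cor. 3.12 — disputed chain) and
`GenEll_thm21_primesWith Λ` («(ii)_Λ ⇒ (i)_Λ»: proved at `Λ = 1`, `GenEll_thm21_primes_holds`; for `Λ > 1` NOT in
print, NOT in reach of the printed noncritical-Belyi mechanism — exponent rigidity, `GenEll.belyi_slope_not_pos`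
— an OPEN hypothesis, never "discharged when ported"). Nothing is asserted unconditionally; no side is taken on
Cor. 3.12. The `Λ`-twin of `abc_of_thm110Legendre`. [claim: Mochizuki2012, status: disputed] -/
theorem abcExp_of_thm110LegendreWith {Λ : ℝ} (hΛ : 1 ≤ Λ) (hH : Thm110LegendreWith Λ)
    (hfact : GenEll_thm21_primesWith Λ) : ABCWithExponent Λ :=
  abcExp_of_abcCompactlyBoundedWith hfact primes_two (abcCompactlyBoundedWith_two_of_thm110LegendreWith hΛ hH)

/-- The same in the dilation currency `μ = 1/Λ` (`0 < μ ≤ 1`): `Thm110LegendreWith (1/μ) →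
GenEll_thm21_primesWith (1/μ) → ABCWithExponent (1/μ)`. [claim: Mochizuki2012, status: disputed] -/
theorem abcExp_of_thm110LegendreWith_one_div {μ : ℝ} (hμ0 : 0 < μ) (hμ1 : μ ≤ 1)
    (hH : Thm110LegendreWith (1 / μ)) (hfact : GenEll_thm21_primesWith (1 / μ)) : ABCWithExponent (1 / μ) :=
  abcExp_of_thm110LegendreWith (one_le_one_div_of_le_one hμ0 hμ1) hH hfact

/-- The Cor. 2.2_Λ-level form (without discharging the Galois-image input or the vacuity remark):
`Corollary22With Λ H_unif → JInvVacuous → GenEll_thm21_primesWith Λ → ABCWithExponent Λ`. The `Λ`-twin of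
`abc_of_corollary22_primes`. [claim: Mochizuki2012, status: disputed] -/
theorem abcExp_of_corollary22With {Λ Hunif : ℝ} (hΛ : 1 ≤ Λ) (h22 : Corollary22With Λ Hunif)
    (hvac : JInvVacuous) (hfact : GenEll_thm21_primesWith Λ) : ABCWithExponent Λ :=
  abcExp_of_abcCompactlyBoundedWith hfact primes_two (abcCompactlyBoundedWith_two_of_corollary22With hΛ h22 hvac)

/-! ## The `Λ = 1` regressions: the record chain BY NAME -/

/-- `Λ = 1`: the `With`-chain's end `ABCCompactlyBoundedWith {2} 1` IS the record's `ABCCompactlyBounded {2}`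
(`abcCompactlyBoundedWith_one_iff`), and `Thm110LegendreWith 1` IS `Thm110Legendre`; so at `Λ = 1` the theorem
`abcCompactlyBoundedWith_two_of_thm110LegendreWith` says exactly what `abcCompactlyBounded_two_of_thm110Legendre`
says. [claim: Mochizuki2012, status: disputed] -/
theorem abcCompactlyBounded_two_of_thm110LegendreWith_one (hH : Thm110LegendreWith 1) :
    ABCCompactlyBounded ({2} : Finset ℕ) :=
  (abcCompactlyBoundedWith_one_iff {2}).1 (abcCompactlyBoundedWith_two_of_thm110LegendreWith le_rfl hH)

/-- `Λ = 1`: the all-triples endpoint needs only the PROVED shape at `Λ = 1` — given as the record fact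
`GenEll_thm21_primes` by name (discharged in the tree: `GenEll_thm21_primes_holds`) — and returns the displayed
abc sentence of `abc_of_thm110Legendre` verbatim (`abcWithExponent_one_iff`). [claim: Mochizuki2012, status: disputed] -/
theorem abc_of_thm110LegendreWith_one (hH : Thm110LegendreWith 1) (hfact : GenEll_thm21_primes) :
    ∀ ε : ℝ, 0 < ε → ∃ C : ℝ, 0 < C ∧
      ∀ a b c : ℕ, IsABCTriple a b c → (c : ℝ) < C * ((rad a b c : ℕ) : ℝ) ^ (1 + ε) :=
  abcWithExponent_one_iff.1
    (abcExp_of_thm110LegendreWith le_rfl hH (genEll_thm21_primesWith_one_iff.2 hfact))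

-- Cross-check (same statement through the record endpoint, not re-declared to avoid a duplicate):
-- `abc_of_thm110Legendre (thm110LegendreWith_one_iff.1 hH) hfact` has exactly the type of
-- `abc_of_thm110LegendreWith_one hH hfact`.
example (hH : Thm110LegendreWith 1) (hfact : GenEll_thm21_primes) :
    ∀ ε : ℝ, 0 < ε → ∃ C : ℝ, 0 < C ∧
      ∀ a b c : ℕ, IsABCTriple a b c → (c : ℝ) < C * ((rad a b c : ℕ) : ℝ) ^ (1 + ε) :=
  abc_of_thm110Legendre (thm110LegendreWith_one_iff.1 hH) hfact

end Cor22

end Literature.IUT.LogVolume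

end
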